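import Summits.HodgeConjecture.HodgeConjecture.Theorems.F0P3ArchIsotypyOfAdmissibleBlock        -- (n1) FILE B′ (A-p14 (g26)): `liso_of_isAdmissibleGK` (L-iso♭ with no letter); brings FILE B (`archLift`, `continuous_archLift`)
import Summits.HodgeConjecture.HodgeConjecture.Theorems.F0P3ArchStructureLetterSplit          -- ★ p839537 (A-p14 (g25)): §0 transports, `toContRep_eq_one_of_cptTriv₀`; brings ★ p838816, J1a frame
import Literature.NumberTheory.Automorphic.UnitaryGlobalizationHilbertAdmissible             -- ★ KF2 `RealMatrixGroup.finiteDimensional_homRangeSum`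
import Literature.NumberTheory.Automorphic.HarishChandraSpaceDenseProofs                   -- ★ `RealMatrixGroup.compactSpace_maximalCompact`
import HarnessLib

/-!
# H3 ⟸ H3-core + L-adm at `K∞` — the structure letter of ROAD «TF» with NEITHER L-iso NOR F1a (J2, (n1)-junction FILE C; A-p14 (g26), 2026-09-01)

Cell `hodgecm-mathlib`, programme P3 «U3-mult», ROAD «TF».  ★ p839537 `F0P3ArchStructureLetterSplit.h3_of_core_of_adm_of_iso` split the structure letter H3 of F0P3a-p07 (g6)'s
assembler into H3-core + L-adm + L-iso.  THIS FILE removes L-iso: with L-adm read at the maximal compact `K∞` of `U(2,1)` — in the Harish-Chandra-module currency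
**L-adm(K∞) := for every `cptTriv₀` class `c`, every compact open `K′`, the level-`K′` block `B` of `rep c` and any descent `σB` of `B` along `archProjUForm`, the
Harish-Chandra module of `σB` is admissible (`IsAdmissibleGK (harishChandraRepK U(2,1) σB)`)** — the `hiso` binder is DISCHARGED by ★ FILE B′ `liso_of_isAdmissibleGK`
(A-p14 (g26): class isotopy of admissible blocks from ★ Harish-Chandra irreducibility under admissibility (FILE A2) + ★ F1a-from-one-admissible-block (B5b) + ★
`clInfChoiceU_eq_ofModule`), because every sub-block of an admissible `B` is admissible (injective ★ `harishChandraMap` of the inclusion).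

* §1 `archLiftK` — `K∞ →* G′_∞` (★ FILE B `archLift` on the maximal compact), continuous; `restrict_archLiftK_eq` — `B.toContRep ∘ archLiftK = σB|_{K∞}` for a descent `σB`;
  `isAdmissibleGK_of_injective'` — admissibility along an injective `K`-map (★ `isAdmissibleGK_of_injective` of `AutomorphicRepsGLIrreducibleL2Adm`, re-proved to keep this
  file's import closure inside the engine); `isAdmissibleGK_harishChandra_of_le` — the Harish-Chandra module of a sub-block of an admissible block is admissible.
* §2 **`h3_of_core_of_admK`** : ‹L-adm(K∞)› → ‹H3-core› → ‹H3 verbatim› — ★ p839537's proof re-run with: `hadm` for ★ p838816 at `(K := K∞, ιK := archLiftK)` supplied by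
  L-adm(K∞) through ★ KF2 `RealMatrixGroup.finiteDimensional_homRangeSum`; `hiso` supplied by ★ FILE B′ inside `B`.

BOOKS (the desk's ∕ director's count): the (H) block of the closer reads **H3 ⟸ {H3-core [FlathCorvallis1979 Thm. 4; BorelJacquet1979 §4.6], L-adm(K∞) [HarishChandra1953
Thms. 4–6; BorelJacquet1979 §4.3 — T3's admissibility row]}**; L-iso and F1a are NOT letters of this block.  THEOREMS + one `def` with body (`archLiftK`); no instance, no notation,
no named fact, no `sorry`.  NON-CLAIMS: nothing on `hdef`; L-adm(K∞) itself is not proved (it is Harish-Chandra finiteness of `𝒜(G, K′)_π`).  HONEST LABEL: HC_CM is proved only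
modulo the 2 remaining named inputs (hLiu418, h413) until rung 0 closes; this file re-types H3, it discharges no printed row by itself.

## References
* D. Flath, *Decomposition of representations into tensor products*, Corvallis 1979, part 1, Thm. 3 and Thm. 4 [FlathCorvallis1979].
* A. Borel, H. Jacquet, *Automorphic forms and automorphic representations*, Corvallis 1979, part 1, §4.3 and §4.6 [BorelJacquet1979].
* Harish-Chandra, *Representations of a semisimple Lie group on a Banach space I*, Trans. AMS 75 (1953), §9 Thm. 4 (p. 224), Thms. 5–6, §11 Thm. 8 (p. 231) [HarishChandraTAMS1953].
* J. Dixmier, *C\*-algebras* (1977), §13.1.2, §13.1.5, §13.1.8 [Dixmier1977].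
-/

-- Mathlib idiom (as in ★ `GKModules`): commutator bracket, needed to MENTION `GKIrrClass (uFormGroup …)` ∕ `IsUnitaryGlobalization` ∕ `harishChandraRepK`.
attribute [local instance 100] LieRing.ofAssociativeRing

set_option autoImplicit false
-- the mandated namespace repeats `HodgeConjecture.HodgeConjecture`, as in every `Theorems/*.lean` of this sub-problem
set_option linter.dupNamespace false

noncomputable section

open MeasureTheory Measure NumberField CompactlySupported Topology
open Literature.NumberTheory.Automorphic Literature.NumberTheory.Automorphic.UnitaryGroup
open Literature.NumberTheory.Automorphic.UnitaryGroup.CotangentForms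
open Literature.RepresentationTheory Literature.RepresentationTheory.KonnoKonno2007 Literature.RepresentationTheory.KonnoKonno2007.RealDualPair
open Literature.RepresentationTheory.BorelWallach2000
open scoped Matrix InnerProductSpace ENNReal

namespace Summit.HodgeConjecture.HodgeConjecture.Cruxes.H413.F0P3ArchStructureOfAdmK

open Summit.HodgeConjecture.HodgeConjecture.Cruxes.H413.F0P3InnerFormClassificationV6
open Summit.HodgeConjecture.HodgeConjecture.Cruxes.H413.F0P3ClassTokensOfRecord (Cls rep)
open Summit.HodgeConjecture.HodgeConjecture.Cruxes.H413.F0P3CompactTrivOfRecord (cptTriv₀)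
open Summit.HodgeConjecture.HodgeConjecture.Cruxes.H413.F0P3UnitaryLocOfRecord (clInfChoiceU)
open Summit.HodgeConjecture.HodgeConjecture.Cruxes.H413.F0P3bArchDegOneClass (archDegOneClass)
open Summit.HodgeConjecture.HodgeConjecture.Cruxes.H413.F0P3LettersTraceFactorisation (IsProductHaar)
open Summit.HodgeConjecture.HodgeConjecture.Cruxes.H413.F0P3ArchTraceOfRealisation (exists_descend_archProjUForm isUnitary_of_descend isStronglyContinuous_of_descend)
open Summit.HodgeConjecture.HodgeConjecture.Cruxes.H413.F0P3ArchFixedBlockDecompositionOfAdmissible (exists_fin_orthogonal_blocks_of_admissible_of_descend)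
open Summit.HodgeConjecture.HodgeConjecture.Cruxes.H413.F0P3ArchStructureLetterSplit (exists_descend_toContRep isUnitaryGlobalization_of_descend_of_areUnitarilyEquivalent toContRep_eq_one_of_cptTriv₀)
open Summit.HodgeConjecture.HodgeConjecture.Cruxes.H413.F0P3ArchBlockClassOfArchIsotypy (archLift continuous_archLift archToAdelic_archLift archProjUForm_archLift)
open Summit.HodgeConjecture.HodgeConjecture.Cruxes.H413.F0P3ArchIsotypyOfAdmissibleBlock (liso_of_isAdmissibleGK)
open ContRepresentation (ClosedSubrep AreUnitarilyEquivalent)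

/-! ## §1 The maximal compact through the archimedean lift; admissibility of sub-blocks -/

section KInfty

variable (L : Type) [Field L] [NumberField L] [IsCMField L] (ι : L →+* ℂ) (H : Matrix (Fin 3) (Fin 3) L) (T : GL (Fin 3) ℂ)
  (hT : (T : Matrix (Fin 3) (Fin 3) ℂ)ᴴ * H.map ι * (T : Matrix (Fin 3) (Fin 3) ℂ) = Literature.Geometry.ComplexHyperbolic.BallModel.J)

/-- **`archLiftK`** — `K∞ = U(2,1) ∩ U(3) →* G′_∞`: the archimedean lift ★ `archLift` (FILE B) restricted to the maximal compact subgroup. [cite: BorelJacquetCorvallis1979, §4.1] -/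
def archLiftK : (uFormGroup (Fin 2) (Fin 1)).maximalCompact →* arch (↥(maximalRealSubfield L)) L (IsCMField.complexConj L) 3 H :=
  (archLift L ι H T hT).comp (Subgroup.inclusion (uFormGroup (Fin 2) (Fin 1)).maximalCompact_le_carrier)

/-- Unfolding `archLiftK`. [cite: BorelJacquetCorvallis1979, §4.1] -/
theorem archLiftK_apply (k : (uFormGroup (Fin 2) (Fin 1)).maximalCompact) :
    archLiftK L ι H T hT k = archLift L ι H T hT (Subgroup.inclusion (uFormGroup (Fin 2) (Fin 1)).maximalCompact_le_carrier k) := rfl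

/-- `archLiftK` is continuous. [cite: BorelJacquetCorvallis1979, §4.1] -/
theorem continuous_archLiftK : Continuous (archLiftK L ι H T hT) :=
  (continuous_archLift L ι H T hT).comp (continuous_induced_rng.2 continuous_subtype_val)

/-- **`B ∘ archLiftK = σB|_{K∞}`**: for a representation `π` of `G′_∞` descending to `σbar` along `archProjUForm`, the pull-back of `π` along `archLiftK` IS the restriction of
`σbar` to `K∞` (★ FILE B `archProjUForm_archLift`). [cite: BorelJacquetCorvallis1979, §4.1] -/
theorem restrict_archLiftK_eq {F : Type*} [NormedAddCommGroup F] [InnerProductSpace ℂ F]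
    {π : ContRepresentation ℂ (arch (↥(maximalRealSubfield L)) L (IsCMField.complexConj L) 3 H) F}
    {σbar : ContRepresentation ℂ (uFormGroup (Fin 2) (Fin 1)).carrier F} (hσ : ∀ g, π g = σbar (archProjUForm L ι H T hT g)) :
    π.restrict (archLiftK L ι H T hT) = σbar.restrict (Subgroup.inclusion (uFormGroup (Fin 2) (Fin 1)).maximalCompact_le_carrier) := by
  change ContRepresentation.ofMonoidHom _ = ContRepresentation.ofMonoidHom _
  refine congrArg _ (MonoidHom.ext fun k => ?_)
  change π (archLiftK L ι H T hT k) = σbar (Subgroup.inclusion (uFormGroup (Fin 2) (Fin 1)).maximalCompact_le_carrier k)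
  rw [hσ, archLiftK_apply, archProjUForm_archLift]

/-- **Admissibility along an injective `K`-map** (★ `isAdmissibleGK_of_injective` of `AutomorphicRepsGLIrreducibleL2Adm`, re-proved to keep the import closure inside the
engine): composition with an injective intertwiner `T : ρ₁ → ρ₂` embeds `Hom_K(τ, ρ₁)` into `Hom_K(τ, ρ₂)`. [cite: WallachRRG1, §3.3.1] -/
theorem isAdmissibleGK_of_injective' {V₁ V₂ : Type*} [AddCommGroup V₁] [Module ℂ V₁] [AddCommGroup V₂] [Module ℂ V₂]
    {ρ₁ : Representation ℂ (uFormGroup (Fin 2) (Fin 1)).maximalCompact V₁} {ρ₂ : Representation ℂ (uFormGroup (Fin 2) (Fin 1)).maximalCompact V₂}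
    (T₁ : ρ₁.IntertwiningMap ρ₂) (hT₁ : Function.Injective T₁) (h : IsAdmissibleGK ρ₂) : IsAdmissibleGK ρ₁ := by
  intro W _ _ _ τ hτ
  haveI := h W τ hτ
  refine Module.Finite.of_injective (Representation.IntertwiningMap.llcomp τ ρ₁ ρ₂ T₁) fun S₁ S₂ hS => ?_
  refine Representation.IntertwiningMap.ext (LinearMap.ext fun w => hT₁ ?_)
  exact congrArg (fun S : τ.IntertwiningMap ρ₂ => S w) hS

/-- **The Harish-Chandra module of a SUB-BLOCK of an admissible block is admissible.**  `π` on `E` and `π'` on `E'` representations of `G′_∞` descending to `σbar`, `σbar'`, and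
`i : E →L E'` an INJECTIVE bounded intertwiner (`i ∘ π g = π' g ∘ i`): then `IsAdmissibleGK (harishChandraRepK σbar') → IsAdmissibleGK (harishChandraRepK σbar)` — the ★
`harishChandraMap` of `i` (an intertwiner `σbar → σbar'` too, by surjectivity of `archProjUForm`) is an injective `K∞`-map of Harish-Chandra modules.
[cite: WallachRRG1, §3.3.1] [cite: BorelJacquetCorvallis1979, §4.3] -/
theorem isAdmissibleGK_harishChandra_of_injective
    {E : Type*} [NormedAddCommGroup E] [InnerProductSpace ℂ E] {E' : Type*} [NormedAddCommGroup E'] [InnerProductSpace ℂ E']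
    {π : ContRepresentation ℂ (arch (↥(maximalRealSubfield L)) L (IsCMField.complexConj L) 3 H) E}
    {π' : ContRepresentation ℂ (arch (↥(maximalRealSubfield L)) L (IsCMField.complexConj L) 3 H) E'}
    {σbar : ContRepresentation ℂ (uFormGroup (Fin 2) (Fin 1)).carrier E} {σbar' : ContRepresentation ℂ (uFormGroup (Fin 2) (Fin 1)).carrier E'}
    (hσ : ∀ g, π g = σbar (archProjUForm L ι H T hT g)) (hσ' : ∀ g, π' g = σbar' (archProjUForm L ι H T hT g))
    (i : E →L[ℂ] E') (hi : ∀ (g : arch (↥(maximalRealSubfield L)) L (IsCMField.complexConj L) 3 H) (v : E), i (π g v) = π' g (i v))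
    (hinj : Function.Injective i) (hadm' : IsAdmissibleGK (harishChandraRepK (uFormGroup (Fin 2) (Fin 1)) σbar')) :
    IsAdmissibleGK (harishChandraRepK (uFormGroup (Fin 2) (Fin 1)) σbar) := by
  have hi' : ∀ (u : (uFormGroup (Fin 2) (Fin 1)).carrier) (v : E), i (σbar u v) = σbar' u (i v) := fun u v => by
    obtain ⟨g, rfl⟩ := archProjUForm_surjective L ι H T hT u
    rw [← hσ, ← hσ']
    exact hi g v
  let T₁ : (harishChandraRepK (uFormGroup (Fin 2) (Fin 1)) σbar).IntertwiningMap (harishChandraRepK (uFormGroup (Fin 2) (Fin 1)) σbar') :=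
    { toLinearMap := Intertwiner.harishChandraMap (uFormGroup (Fin 2) (Fin 1)) hi'
      isIntertwining' := fun k => LinearMap.ext fun v => Intertwiner.harishChandraMap_repK (uFormGroup (Fin 2) (Fin 1)) hi' k v }
  refine isAdmissibleGK_of_injective' T₁ (fun v w hvw => ?_) hadm'
  apply Subtype.ext
  apply hinj
  have h1 : (Intertwiner.harishChandraMap (uFormGroup (Fin 2) (Fin 1)) hi' v : E') = Intertwiner.harishChandraMap (uFormGroup (Fin 2) (Fin 1)) hi' w :=
    congrArg Subtype.val hvw
  rwa [Intertwiner.coe_harishChandraMap_apply, Intertwiner.coe_harishChandraMap_apply] at h1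

end KInfty

/-! ## §2 H3 from H3-core and L-adm at `K∞` -/

variable (L : Type) [Field L] [NumberField L] [IsCMField L] (H : Matrix (Fin 3) (Fin 3) L) (ι : L →+* ℂ) (T : GL (Fin 3) ℂ)
  (hT : (T : Matrix (Fin 3) (Fin 3) ℂ)ᴴ * H.map ι * (T : Matrix (Fin 3) (Fin 3) ℂ) = Literature.Geometry.ComplexHyperbolic.BallModel.J)
  (μ : Measure (Gp L H).automorphicQuotient) [(Gp L H).IsAutomorphicMeasure μ]
  [MeasurableSpace (Gp L H).Adelic] (ν : Measure (Gp L H).Adelic)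
  (νinf : @Measure (UnitaryGroup.arch (↥(maximalRealSubfield L)) L (IsCMField.complexConj L) 3 H) (borel _))
  (μv : ∀ v : Places L, @Measure ((cmDatum L 3 H).Local v) (borel _))

-- one long statement (the letter H3 twice) and the instance-path unifications `ClosedSubrep B.toContRep` ↔ ★ p838816's spelling (as in ★ p839537: 3.2M measured there)
set_option maxHeartbeats 3200000 in
/-- **H3 ⟸ H3-core + L-adm(K∞).**  Hypotheses: `hadmK` = L-adm at `K∞` (for every `cptTriv₀` class `c`, every compact open `K′`, the level-`K′` block `B` of `rep c` and every
descent `σB` of `B` along `archProjUForm`, the Harish-Chandra module of `σB` is `K∞`-admissible), `hcore` = H3-core ((σ) + the trace identity (b) for EVERY admissible block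
family, ★ p839537's binder verbatim).  Conclusion: the structure letter H3 VERBATIM.  PROOF = ★ p839537's with `hadm` for ★ p838816 at `(K∞, archLiftK)` via ★ KF2 and `hiso`
by ★ FILE B′ `liso_of_isAdmissibleGK` inside `B` (sub-blocks of `B` admissible by §1). [cite: FlathCorvallis1979, Thm. 3 and Thm. 4] [cite: BorelJacquet1979, §4.3 and §4.6]
[cite: HarishChandraTAMS1953, §9 Thm. 4 (p. 224), §11 Thm. 8 (p. 231)] [cite: Dixmier1977, §13.1.2, §13.1.5, §13.1.8] -/
theorem h3_of_core_of_admK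
    (hadmK : ∀ c : Cls (Gp L H) μ, cptTriv₀ L ι H T hT μ c →
      ∀ (K' : Subgroup (finAdelic (↥(maximalRealSubfield L)) L (IsCMField.complexConj L) 3 H)),
        IsOpen (K' : Set (finAdelic (↥(maximalRealSubfield L)) L (IsCMField.complexConj L) 3 H)) →
        IsCompact (K' : Set (finAdelic (↥(maximalRealSubfield L)) L (IsCMField.complexConj L) 3 H)) →
        ∀ B : ClosedSubrep (((Gp L H).rightRegular μ).restrict (archToAdelic (↥(maximalRealSubfield L)) L (IsCMField.complexConj L) 3 H)),
          (∀ w : (Gp L H).L2 μ, w ∈ B.toSubmodule ↔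
            (w ∈ (rep (Gp L H) μ c).space.toSubmodule ∧
              ∀ k ∈ K', (Gp L H).rightRegular μ (finAdelicToAdelic (↥(maximalRealSubfield L)) L (IsCMField.complexConj L) 3 H k) w = w)) →
          ∀ σB : ContRepresentation ℂ (uFormGroup (Fin 2) (Fin 1)).carrier B.toSubmodule,
            (∀ g, B.toContRep g = σB (archProjUForm L ι H T hT g)) →
            IsAdmissibleGK (harishChandraRepK (uFormGroup (Fin 2) (Fin 1)) σB))
    (hcore :
      letI : MeasurableSpace (UnitaryGroup.arch (↥(maximalRealSubfield L)) L (IsCMField.complexConj L) 3 H) := borel _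
      letI : MeasurableSpace (finAdelic (↥(maximalRealSubfield L)) L (IsCMField.complexConj L) 3 H) := borel _
      haveI : BorelSpace (finAdelic (↥(maximalRealSubfield L)) L (IsCMField.complexConj L) 3 H) := ⟨rfl⟩
      IsProductHaar L H ν νinf μv →
        ∀ (νf : Measure (finAdelic (↥(maximalRealSubfield L)) L (IsCMField.complexConj L) 3 H)),
          ν = Measure.map (adelicProdEquiv (↥(maximalRealSubfield L)) L (IsCMField.complexConj L) 3 H).symm.toMulEquiv (νinf.prod νf) →
          ∀ c : Cls (Gp L H) μ, cptTriv₀ L ι H T hT μ c →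
            ∃ (W : Type) (_ : AddCommGroup W) (_ : Module ℂ W) (σ : Representation ℂ (finAdelic (↥(maximalRealSubfield L)) L (IsCMField.complexConj L) 3 H) W),
              σ.IsIrreducible ∧ σ.IsAdmissible ∧ σ.IsSmooth ∧ (rep (Gp L H) μ c).HasFinComponent σ ∧
              ∀ (K' : Subgroup (finAdelic (↥(maximalRealSubfield L)) L (IsCMField.complexConj L) 3 H)),
                IsOpen (K' : Set (finAdelic (↥(maximalRealSubfield L)) L (IsCMField.complexConj L) 3 H)) →
                IsCompact (K' : Set (finAdelic (↥(maximalRealSubfield L)) L (IsCMField.complexConj L) 3 H)) →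
                ∀ (n : ℕ)
                  (W : Fin n → ClosedSubrep (((Gp L H).rightRegular μ).restrict (archToAdelic (↥(maximalRealSubfield L)) L (IsCMField.complexConj L) 3 H)))
                  (σbar : ∀ i, ContRepresentation ℂ (uFormGroup (Fin 2) (Fin 1)).carrier (W i).toSubmodule),
                  (∀ i j, i ≠ j → (W i).toSubmodule ⟂ (W j).toSubmodule) →
                  (∀ i, (W i).toSubmodule ≤ (rep (Gp L H) μ c).space.toSubmodule) →
                  (∀ i g, (W i).toContRep g = σbar i (archProjUForm L ι H T hT g)) →
                  (∀ i, IsUnitaryGlobalization (uFormGroup (Fin 2) (Fin 1))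
                    (clInfChoiceU L H ι T hT μ (archDegOneClass 1 (Or.inl rfl)) (rep (Gp L H) μ c)) (σbar i)) →
                  (∀ w : (Gp L H).L2 μ, w ∈ (rep (Gp L H) μ c).space.toSubmodule →
                    (∀ k ∈ K', (Gp L H).rightRegular μ (finAdelicToAdelic (↥(maximalRealSubfield L)) L (IsCMField.complexConj L) 3 H k) w = w) →
                    w ∈ ⨆ i, (W i).toSubmodule) →
                  ∀ (Λ : C_c(finAdelic (↥(maximalRealSubfield L)) L (IsCMField.complexConj L) 3 H, ℂ)),
                    (∀ k ∈ K', ∀ b, Λ (b * k) = Λ b) → (∀ k ∈ K', ∀ b, Λ (k * b) = Λ b) →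
                    ∀ (u : Fin n → (Gp L H).L2 μ), (∀ i, u i ∈ (W i).toSubmodule ∧ ‖u i‖ = 1) →
                    ∀ [IsFiniteMeasureOnCompacts νf],
                      ∑ i, ⟪u i, (((Gp L H).rightRegular μ).restrict (finAdelicToAdelic (↥(maximalRealSubfield L)) L (IsCMField.complexConj L) 3 H)).integratedOperator
                          (((Gp L H).isUnitary_rightRegular μ).restrict _)
                          (((Gp L H).isStronglyContinuous_rightRegular_holds μ).restrict _
                            (continuous_finAdelicToAdelic (↥(maximalRealSubfield L)) L (IsCMField.complexConj L) 3 H)) νf Λ (u i)⟫_ℂ =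
                        σ.smoothTrace νf ⇑Λ) :
    letI : MeasurableSpace (UnitaryGroup.arch (↥(maximalRealSubfield L)) L (IsCMField.complexConj L) 3 H) := borel _
    letI : MeasurableSpace (finAdelic (↥(maximalRealSubfield L)) L (IsCMField.complexConj L) 3 H) := borel _
    haveI : BorelSpace (finAdelic (↥(maximalRealSubfield L)) L (IsCMField.complexConj L) 3 H) := ⟨rfl⟩
    IsProductHaar L H ν νinf μv →
      ∀ (νf : Measure (finAdelic (↥(maximalRealSubfield L)) L (IsCMField.complexConj L) 3 H)),
        ν = Measure.map (adelicProdEquiv (↥(maximalRealSubfield L)) L (IsCMField.complexConj L) 3 H).symm.toMulEquiv (νinf.prod νf) →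
        ∀ c : Cls (Gp L H) μ, cptTriv₀ L ι H T hT μ c →
          ∃ (W : Type) (_ : AddCommGroup W) (_ : Module ℂ W) (σ : Representation ℂ (finAdelic (↥(maximalRealSubfield L)) L (IsCMField.complexConj L) 3 H) W),
            σ.IsIrreducible ∧ σ.IsAdmissible ∧ σ.IsSmooth ∧ (rep (Gp L H) μ c).HasFinComponent σ ∧
            ∀ (K' : Subgroup (finAdelic (↥(maximalRealSubfield L)) L (IsCMField.complexConj L) 3 H)),
              IsOpen (K' : Set (finAdelic (↥(maximalRealSubfield L)) L (IsCMField.complexConj L) 3 H)) →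
              IsCompact (K' : Set (finAdelic (↥(maximalRealSubfield L)) L (IsCMField.complexConj L) 3 H)) →
              ∃ (n : ℕ)
                (W : Fin n → ClosedSubrep (((Gp L H).rightRegular μ).restrict (archToAdelic (↥(maximalRealSubfield L)) L (IsCMField.complexConj L) 3 H)))
                (σbar : ∀ i, ContRepresentation ℂ (uFormGroup (Fin 2) (Fin 1)).carrier (W i).toSubmodule),
                (∀ i j, i ≠ j → (W i).toSubmodule ⟂ (W j).toSubmodule) ∧
                (∀ i, (W i).toSubmodule ≤ (rep (Gp L H) μ c).space.toSubmodule) ∧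
                (∀ i g, (W i).toContRep g = σbar i (archProjUForm L ι H T hT g)) ∧
                (∀ i, IsUnitaryGlobalization (uFormGroup (Fin 2) (Fin 1))
                  (clInfChoiceU L H ι T hT μ (archDegOneClass 1 (Or.inl rfl)) (rep (Gp L H) μ c)) (σbar i)) ∧
                (∀ w : (Gp L H).L2 μ, w ∈ (rep (Gp L H) μ c).space.toSubmodule →
                  (∀ k ∈ K', (Gp L H).rightRegular μ (finAdelicToAdelic (↥(maximalRealSubfield L)) L (IsCMField.complexConj L) 3 H k) w = w) →
                  w ∈ ⨆ i, (W i).toSubmodule) ∧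
                (∀ (Λ : C_c(finAdelic (↥(maximalRealSubfield L)) L (IsCMField.complexConj L) 3 H, ℂ)),
                  (∀ k ∈ K', ∀ b, Λ (b * k) = Λ b) → (∀ k ∈ K', ∀ b, Λ (k * b) = Λ b) →
                  ∀ (u : Fin n → (Gp L H).L2 μ), (∀ i, u i ∈ (W i).toSubmodule ∧ ‖u i‖ = 1) →
                  ∀ [IsFiniteMeasureOnCompacts νf],
                    ∑ i, ⟪u i, (((Gp L H).rightRegular μ).restrict (finAdelicToAdelic (↥(maximalRealSubfield L)) L (IsCMField.complexConj L) 3 H)).integratedOperator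
                        (((Gp L H).isUnitary_rightRegular μ).restrict _)
                        (((Gp L H).isStronglyContinuous_rightRegular_holds μ).restrict _
                          (continuous_finAdelicToAdelic (↥(maximalRealSubfield L)) L (IsCMField.complexConj L) 3 H)) νf Λ (u i)⟫_ℂ =
                      σ.smoothTrace νf ⇑Λ) := by
  intro hPH νf hν c hc
  obtain ⟨Wσ, i1, i2, σ, hirr, hadmσ, hsm, hfin, hK⟩ := hcore hPH νf hν c hc
  refine ⟨Wσ, i1, i2, σ, hirr, hadmσ, hsm, hfin, fun K' hKo hKc => ?_⟩
  -- the ambient representation of `G′_∞` on `L²`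
  have hRu : ((Gp L H).rightRegular μ).IsUnitary := (Gp L H).isUnitary_rightRegular μ
  have hRc : ((Gp L H).rightRegular μ).IsStronglyContinuous := (Gp L H).isStronglyContinuous_rightRegular_holds μ
  have hπu : (((Gp L H).rightRegular μ).restrict (archToAdelic (↥(maximalRealSubfield L)) L (IsCMField.complexConj L) 3 H)).IsUnitary :=
    hRu.restrict _
  have hπc : (((Gp L H).rightRegular μ).restrict (archToAdelic (↥(maximalRealSubfield L)) L (IsCMField.complexConj L) 3 H)).IsStronglyContinuous :=
    hRc.restrict _ (continuous_archToAdelic (↥(maximalRealSubfield L)) L (IsCMField.complexConj L) 3 H)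
  -- the level-`K'` block `B` of `rep c` (an opaque witness with its membership characterisation), exactly as in ★ p839537
  obtain ⟨B, hBchar⟩ : ∃ B : ClosedSubrep (((Gp L H).rightRegular μ).restrict (archToAdelic (↥(maximalRealSubfield L)) L (IsCMField.complexConj L) 3 H)),
      ∀ w : (Gp L H).L2 μ, w ∈ B.toSubmodule ↔
        (w ∈ (rep (Gp L H) μ c).space.toSubmodule ∧
          ∀ k ∈ K', (Gp L H).rightRegular μ (finAdelicToAdelic (↥(maximalRealSubfield L)) L (IsCMField.complexConj L) 3 H k) w = w) :=
   ⟨{ toSubmodule :=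
        { carrier := {w | w ∈ (rep (Gp L H) μ c).space.toSubmodule ∧
            ∀ k ∈ K', (Gp L H).rightRegular μ (finAdelicToAdelic (↥(maximalRealSubfield L)) L (IsCMField.complexConj L) 3 H k) w = w}
          add_mem' := fun {a b} ha hb => ⟨Submodule.add_mem _ ha.1 hb.1, fun k hk => by rw [map_add, ha.2 k hk, hb.2 k hk]⟩
          zero_mem' := ⟨Submodule.zero_mem _, fun k _ => map_zero _⟩
          smul_mem' := fun a {w} hw => ⟨Submodule.smul_mem _ a hw.1, fun k hk => by rw [map_smul, hw.2 k hk]⟩ }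
      apply_mem_toSubmodule := fun g {w} hw => by
        refine ⟨(rep (Gp L H) μ c).space.apply_mem (archToAdelic (↥(maximalRealSubfield L)) L (IsCMField.complexConj L) 3 H g) hw.1,
          fun k hk => ?_⟩
        change (Gp L H).rightRegular μ (finAdelicToAdelic _ L _ 3 H k)
            ((Gp L H).rightRegular μ (archToAdelic _ L _ 3 H g) w) = (Gp L H).rightRegular μ (archToAdelic _ L _ 3 H g) w
        have hmul : ∀ (a b : (Gp L H).Adelic) (w' : (Gp L H).L2 μ),
            (Gp L H).rightRegular μ (a * b) w' = (Gp L H).rightRegular μ a ((Gp L H).rightRegular μ b w') := fun a b w' => by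
          rw [map_mul]; rfl
        rw [← hmul, ← (commute_archToAdelic_finAdelicToAdelic (↥(maximalRealSubfield L)) L (IsCMField.complexConj L) 3 H g k).eq, hmul,
          hw.2 k hk]
      isClosed' := by
        change IsClosed {w : (Gp L H).L2 μ | w ∈ (rep (Gp L H) μ c).space.toSubmodule ∧
            ∀ k ∈ K', (Gp L H).rightRegular μ (finAdelicToAdelic (↥(maximalRealSubfield L)) L (IsCMField.complexConj L) 3 H k) w = w}
        have h1 : IsClosed {w : (Gp L H).L2 μ |
            ∀ k ∈ K', (Gp L H).rightRegular μ (finAdelicToAdelic (↥(maximalRealSubfield L)) L (IsCMField.complexConj L) 3 H k) w = w} := by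
          rw [Set.setOf_forall]
          refine isClosed_iInter fun k => ?_
          by_cases hk : k ∈ K'
          · have h3 : {w : (Gp L H).L2 μ | k ∈ K' →
                  (Gp L H).rightRegular μ (finAdelicToAdelic (↥(maximalRealSubfield L)) L (IsCMField.complexConj L) 3 H k) w = w} =
                {w | (Gp L H).rightRegular μ (finAdelicToAdelic (↥(maximalRealSubfield L)) L (IsCMField.complexConj L) 3 H k) w = w} := by
              ext w; simp only [Set.mem_setOf_eq, hk, forall_true_left]
            rw [h3]
            exact isClosed_eq ((Gp L H).rightRegular μ _).continuous continuous_id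
          · have h3 : {w : (Gp L H).L2 μ | k ∈ K' →
                  (Gp L H).rightRegular μ (finAdelicToAdelic (↥(maximalRealSubfield L)) L (IsCMField.complexConj L) 3 H k) w = w} = Set.univ := by
              ext w; simp only [Set.mem_setOf_eq, hk, IsEmpty.forall_iff, Set.mem_univ]
            rw [h3]
            exact isClosed_univ
        have h2 : IsClosed {w : (Gp L H).L2 μ | w ∈ (rep (Gp L H) μ c).space.toSubmodule} := (rep (Gp L H) μ c).space.isClosed
        rw [Set.setOf_and]
        exact h2.inter h1 }, fun w => Iff.rfl⟩
  have hBle : B.toSubmodule ≤ (rep (Gp L H) μ c).space.toSubmodule := fun w hw => ((hBchar w).1 hw).1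
  have hBu : B.toContRep.IsUnitary := hπu.toContRep B
  have hBc : B.toContRep.IsStronglyContinuous := fun v => by
    have h1 : Continuous fun g => ((B.toContRep g v : B.toSubmodule) : (Gp L H).L2 μ) := by
      simp only [ClosedSubrep.coe_toContRep_apply]
      exact hπc (v : (Gp L H).L2 μ)
    exact continuous_induced_rng.2 h1
  -- inflated blocks lie in `rep c`
  have hinfl_le : ∀ Wb : ClosedSubrep B.toContRep, (B.inflate Wb).toSubmodule ≤ (rep (Gp L H) μ c).space.toSubmodule :=
    fun Wb v hv => hBle ((B.inflate_le Wb) hv)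
  have hkerB : ∀ g, archProjUForm L ι H T hT g = 1 → B.toContRep g = 1 := toContRep_eq_one_of_cptTriv₀ L H ι T hT μ c hc B hBle
  -- the descent `σB` of `B` and L-adm(K∞)
  obtain ⟨σB, hσB⟩ := exists_descend_archProjUForm L ι H T hT B.toContRep hkerB
  have hσBu : σB.IsUnitary := isUnitary_of_descend L ι H T hT hσB hBu
  have hσBc : σB.IsStronglyContinuous := isStronglyContinuous_of_descend L ι H T hT hσB hBc
  have hadmB : IsAdmissibleGK (harishChandraRepK (uFormGroup (Fin 2) (Fin 1)) σB) := hadmK c hc K' hKo hKc B hBchar σB hσB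
  -- admissibility of the Harish-Chandra module of every inflated sub-block (injective inclusion into `B`)
  have hadm_infl : ∀ (Wb : ClosedSubrep B.toContRep) (σ' : ContRepresentation ℂ (uFormGroup (Fin 2) (Fin 1)).carrier (B.inflate Wb).toSubmodule),
      (∀ g, (B.inflate Wb).toContRep g = σ' (archProjUForm L ι H T hT g)) → IsAdmissibleGK (harishChandraRepK (uFormGroup (Fin 2) (Fin 1)) σ') := by
    intro Wb σ' hσ'
    refine isAdmissibleGK_harishChandra_of_injective L ι H T hT hσ' hσB
      (⟨Submodule.inclusion (B.inflate_le Wb), continuous_inclusion (B.inflate_le Wb)⟩ : (B.inflate Wb).toSubmodule →L[ℂ] B.toSubmodule)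
      (fun g v => Subtype.ext ?_) (Submodule.inclusion_injective (B.inflate_le Wb)) hadmB
    change (((B.inflate Wb).toContRep g v : (B.inflate Wb).toSubmodule) : (Gp L H).L2 μ) =
      ((B.toContRep g ⟨(v : (Gp L H).L2 μ), B.inflate_le Wb v.2⟩ : B.toSubmodule) : (Gp L H).L2 μ)
    rw [ClosedSubrep.coe_toContRep_apply, ClosedSubrep.coe_toContRep_apply]
  -- ★ p838816 on `B` at `(K∞, archLiftK)`: `hadm` from L-adm(K∞) through ★ KF2, `hiso` from ★ FILE B′ on the INFLATED block + transport
  haveI : CompactSpace (uFormGroup (Fin 2) (Fin 1)).maximalCompact := RealMatrixGroup.compactSpace_maximalCompact (uFormGroup (Fin 2) (Fin 1))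
  have hcK : (B.toContRep.restrict (archLiftK L ι H T hT)).IsStronglyContinuous := hBc.restrict _ (continuous_archLiftK L ι H T hT)
  have hrest := restrict_archLiftK_eq L ι H T hT hσB
  obtain ⟨n, Wb, -, horthb, hirrb, -, -, htop⟩ :=
    exists_fin_orthogonal_blocks_of_admissible_of_descend L ι H T hT
      (x := clInfChoiceU L H ι T hT μ (archDegOneClass 1 (Or.inl rfl)) (rep (Gp L H) μ c)) hBu (archLiftK L ι H T hT) hcK
      (by
        rw [hrest]
        intro F hF _ hFirr
        haveI : FiniteDimensional ℂ ((((σB.restrict (Subgroup.inclusion (uFormGroup (Fin 2) (Fin 1)).maximalCompact_le_carrier)).subRep F hF)).IntertwiningMap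
            ((σB.restrict (Subgroup.inclusion (uFormGroup (Fin 2) (Fin 1)).maximalCompact_le_carrier)).subRep
              (harishChandraSpace (uFormGroup (Fin 2) (Fin 1)) σB) ((uFormGroup (Fin 2) (Fin 1)).restrict_mem_harishChandraSpace))) :=
          hadmB _ _ hFirr
        exact (uFormGroup (Fin 2) (Fin 1)).finiteDimensional_homRangeSum _ hσBu hσBc)
      (fun Wb hWb => by
        -- the same block, read as a `ClosedSubrep B.toContRep` in the ambient spelling
        let Wr : ClosedSubrep B.toContRep := Wb
        have hirr' : (B.inflate Wr).toContRep.IsTopIrreducible := (B.isTopIrreducible_inflate_iff Wr).2 hWb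
        obtain ⟨σ', hσ'⟩ := exists_descend_archProjUForm L ι H T hT (B.inflate Wr).toContRep
          (toContRep_eq_one_of_cptTriv₀ L H ι T hT μ c hc (B.inflate Wr) (hinfl_le Wr))
        have hglob' := liso_of_isAdmissibleGK L ι H T hT (archDegOneClass 1 (Or.inl rfl)) c (B.inflate Wr) (hinfl_le Wr) hirr' σ' hσ'
          (hadm_infl Wr σ' hσ')
        obtain ⟨σb, hσb⟩ := exists_descend_toContRep L ι H T hT hkerB Wb
        exact ⟨σb, hσb, isUnitaryGlobalization_of_descend_of_areUnitarilyEquivalent L ι H T hT hBu hBc Wb hσb hσ'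
          (B.areUnitarilyEquivalent_inflate Wr).symm hglob'⟩)
  -- the blocks, read as `ClosedSubrep B.toContRep` in the ambient spelling; inflate to `L²` and descend afresh
  let Wr : Fin n → ClosedSubrep B.toContRep := Wb
  have horthr : ∀ i j, i ≠ j → (Wr i).toSubmodule ⟂ (Wr j).toSubmodule := horthb
  have hirrr : ∀ i, (Wr i).toContRep.IsTopIrreducible := hirrb
  have htopr : (⨆ i, (Wr i).toSubmodule) = ⊤ := htop
  choose σbar hσbar using fun i => exists_descend_archProjUForm L ι H T hT (B.inflate (Wr i)).toContRep
    (toContRep_eq_one_of_cptTriv₀ L H ι T hT μ c hc (B.inflate (Wr i)) (hinfl_le (Wr i)))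
  have horth : ∀ i j, i ≠ j → (B.inflate (Wr i)).toSubmodule ⟂ (B.inflate (Wr j)).toSubmodule :=
    fun i j hij => (B.isOrtho_inflate_iff).2 (horthr i j hij)
  have hle : ∀ i, (B.inflate (Wr i)).toSubmodule ≤ (rep (Gp L H) μ c).space.toSubmodule := fun i => hinfl_le (Wr i)
  have hglob : ∀ i, IsUnitaryGlobalization (uFormGroup (Fin 2) (Fin 1))
      (clInfChoiceU L H ι T hT μ (archDegOneClass 1 (Or.inl rfl)) (rep (Gp L H) μ c)) (σbar i) := fun i =>
    liso_of_isAdmissibleGK L ι H T hT (archDegOneClass 1 (Or.inl rfl)) c (B.inflate (Wr i)) (hle i)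
      ((B.isTopIrreducible_inflate_iff (Wr i)).2 (hirrr i)) (σbar i) (hσbar i) (hadm_infl (Wr i) (σbar i) (hσbar i))
  have hexh : ∀ w : (Gp L H).L2 μ, w ∈ (rep (Gp L H) μ c).space.toSubmodule →
      (∀ k ∈ K', (Gp L H).rightRegular μ (finAdelicToAdelic (↥(maximalRealSubfield L)) L (IsCMField.complexConj L) 3 H k) w = w) →
      w ∈ ⨆ i, (B.inflate (Wr i)).toSubmodule := by
    intro w hw hfix
    have hwB : w ∈ B.toSubmodule := (hBchar w).2 ⟨hw, hfix⟩
    have h1 : (⟨w, hwB⟩ : B.toSubmodule) ∈ ⨆ i, (Wr i).toSubmodule := by rw [htopr]; exact Submodule.mem_top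
    have h2 : w ∈ (⨆ i, (Wr i).toSubmodule).map B.toSubmodule.subtype := ⟨⟨w, hwB⟩, h1, rfl⟩
    rw [Submodule.map_iSup] at h2
    simpa only [ClosedSubrep.toSubmodule_inflate] using h2
  exact ⟨n, fun i => B.inflate (Wr i), σbar, horth, hle, hσbar, hglob, hexh,
    hK K' hKo hKc n (fun i => B.inflate (Wr i)) σbar horth hle hσbar hglob hexh⟩

end Summit.HodgeConjecture.HodgeConjecture.Cruxes.H413.F0P3ArchStructureOfAdmK

end
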